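import Summits.ResolutionOfSingularities.ResolutionOfSingularities.Theorems.FrobeniusClosingSteerCore4DictionaryOfChartStep
import Summits.ResolutionOfSingularities.ResolutionOfSingularities.Theorems.FrobeniusClosingSteerCore4IsoChartStep
import HarnessLib

/-!
# Crux `Steer` (stmt-ResolutionOfSingularities-16345), line `switching_dichotomy` — the registered stub
# `stub_core4Dictionary` PROVED (chain W4.1: lead res-L0-w41-lead-1 with res-L0-w41-stub-1/2/3/4)

OURS (campaign res-hironaka, rung L, slot W4.1; replaces the role of no printed item; NOT a statement of the
manuscript under review; AI-written, weaker than expert review). **The valuation-run dictionary, closed.** Along a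
zero-dimensional valuation ring `O` over a PERFECT field `k` of characteristic `p`, over a finitely generated base
regular at the (closed-point) centre, an ETERNAL torsor run `s` of the `α_p`-torsor `T^p = t^p` along the quadratic
sequence `R` of the base at the centres of `O` (strict transforms `s i = x_i · s (i+1) + g_i`, `x_i` an exceptional
parameter, `g_i ∈ R i` a `p`-th-power cleaner) is NON-ISOLATED at infinitely many stages: the Jacobian ideal
`(δ (s_i^p) : δ ∈ Der_ℤ (R i))` fails to contain a power of every element of the centre again and again. This is the
one place in the line where the antecedent `IsolatedForcedTermination` of `Steer` (a THEOREM of the tree,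
`…Theorems.WildCones.IsolatedForcedTermination_proof`, p459384) is CONSUMED: Cohen charts
`R i →+* κ⟦X_1..X_d⟧` over `κ = (ResidueField O)^alg` (T1 `ChartZero.chart_zero`, res-L0-w41-stub-4, p478399)
propagate along the quadratic sequence at possibly non-rational centres (T2 `ChartStep.chart_step`,
res-L0-w41-stub-1 with stub-3/stub-4's `…SimpleRoot`/`…Dim`/`…FC2`), Jacobian ideals primary to the centre become
`(X)`-primary ideals of partials (I `Isol.isol_transfer`, res-L0-w41-stub-2, p479356), the blow-up substitution
raises `X_j`-divisibility only as far as the order allows (S `order_le_of_X_pow_dvd_subst`, res-L0-w41-stub-3,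
p481022), and the leaf (`Core4Dictionary.stub_core4Dictionary_of_dict`, lead, p480356 + p480959 + p481556) reads the
run as an `InfRun` of the typed point-blow-up dynamics of `Theorems.WildCones`, which the antecedent forbids.
The statement below is the registered `Sig.stub_core4Dictionary` of `Cruxes/Steer/Lines/switching_dichotomy.lean`
(r9/r10) with the line's vocabulary (`ZeroDim`, `locAtCentre`-sequence, `IsTorsorRun`, `IsolAt`) unfolded verbatim.
[cite: HauserPerlega2019, §§2–3] [cite: Matsumura1987, Thms. 28.3, 29.7]
-/

noncomputable section

-- single-problem summit: the doubled namespace component `ResolutionOfSingularities` is forced by the tree layout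
set_option linter.dupNamespace false

open Literature.AlgebraicGeometry.Resolution
open MvPowerSeries IsLocalRing

namespace Summit.ResolutionOfSingularities.ResolutionOfSingularities.Theorems.SwitchingDichotomy

/-- **T2 of the leaf, from the tree** (`ChartStep.chart_step`, res-L0-w41-stub-1). [folklore] -/
theorem Core4Dictionary.dictT2_holds :
    (∀ {K : Type} [Field K] (O : ValuationSubring K) {κ : Type} [Field κ] (ι : ResidueField O →+* κ)
      (k₀ : Subfield κ) [PerfectField k₀], Algebra.IsAlgebraic k₀ κ →
      ∀ (R R₁ : Subring K) (hR : R ≤ O.toSubring) (hR₁ : R₁ ≤ O.toSubring)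
      [IsRegularLocalRing R], SubringDominates R O.toSubring → (hQ : IsQuadraticTransformAlong O R R₁) →
      (∀ a ∈ k₀, ∃ r : R, ι (residue O (Subring.inclusion hR r)) = a) →
      ∀ (d : ℕ), (maximalIdeal R).spanFinrank = d → ∀ (φ : R →+* MvPowerSeries (Fin d) κ),
      (∀ r : R, constantCoeff (φ r) = ι (residue O (Subring.inclusion hR r))) →
      Ideal.map φ (Ideal.comap (Subring.inclusion hR) (maximalIdeal O)) =
        Ideal.span (Set.range (X : Fin d → MvPowerSeries (Fin d) κ)) →
      ∀ (x : K), x ≠ 0 → ∀ (hxR : x ∈ R), O.valuation x < 1 →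
      (∀ y ∈ R, O.valuation y < 1 → y / x ∈ R₁) →
      ∃ (j : Fin d) (τ : Fin d → κ) (φ₁ : R₁ →+* MvPowerSeries (Fin d) κ),
        (∀ r : R₁, constantCoeff (φ₁ r) = ι (residue O (Subring.inclusion hR₁ r))) ∧
        Ideal.map φ₁ (Ideal.comap (Subring.inclusion hR₁) (maximalIdeal O)) =
          Ideal.span (Set.range (X : Fin d → MvPowerSeries (Fin d) κ)) ∧
        (∀ r : R, φ₁ (Subring.inclusion hQ.le r) =
          subst (fun s : Fin d => if s = j then (X j : MvPowerSeries (Fin d) κ) else X j * (X s + C (τ s)))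
            (φ r)) ∧
        (∃ w : MvPowerSeries (Fin d) κ, IsUnit w ∧ φ₁ ⟨x, hQ.le hxR⟩ = X j * w) ∧
        (Ideal.comap (Subring.inclusion hR₁) (maximalIdeal O)).spanFinrank = d) := by
  intro K _ O κ _ ι k₀ _ halg R R₁ hR hR₁ _ hdom hQ hk₀ d hd φ h1 h2 x hx0 hxR hxv hdiv
  exact ChartStep.chart_step O ι k₀ halg R R₁ hR hR₁ hdom hQ hk₀ d hd φ h1 h2 x hx0 hxR hxv hdiv

/-- The registered Prop of the stub `stub_core4Dictionary` of crux `Steer` (skeleton r9/r10 of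
`Cruxes/Steer/Lines/switching_dichotomy.lean`), the line's vocabulary (`ZeroDim`, `IsTorsorRun`, `IsolAt`) unfolded
verbatim; private, only to give the closing theorem its registered header. -/
private def Sig.stub_core4Dictionary : Prop :=
    Theses.FrobeniusClosing.IsolatedForcedTermination → ∀ p : ℕ, p.Prime →
    ∀ (k K : Type) [Field k] [CharP k p] [PerfectField k] [Field K] [Algebra k K]
    (O : ValuationSubring K) (A₀ : Subalgebra k K) (h₀ : A₀.toSubring ≤ O.toSubring) (t : K),
    A₀.FG → t ^ p ∈ A₀ → IsFractionRing (Algebra.adjoin k (insert t (A₀ : Set K))) K →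
    IsRegularLocalRing (Localization.AtPrime
      (Ideal.comap (Subring.inclusion h₀) (IsLocalRing.maximalIdeal O))) →
    (∀ x ∈ O, ∃ f : Polynomial k, f ≠ 0 ∧ Polynomial.aeval x f ∈ O.nonunits) →
    ∀ R : ℕ → Subring K, R 0 = locAtCentre A₀.toSubring O →
      (∀ i, IsQuadraticTransformAlong O (R i) (R (i + 1))) →
      ∀ s : ℕ → K, (s 0 = t ∧ (∀ i, s i ^ p ∈ R i) ∧
          ∀ i, ∃ x g : K, (x ∈ R i ∧ x ≠ 0 ∧ O.valuation x < 1 ∧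
            ∀ y ∈ R i, O.valuation y < 1 → O.valuation y ≤ O.valuation x) ∧
            g ∈ R i ∧ s i = x * s (i + 1) + g) →
      ∀ i₀ : ℕ, ∃ i, i₀ ≤ i ∧ ¬ (∃ (hf : s i ^ p ∈ R i) (N : ℕ), ∀ y : R i,
          O.valuation (y : K) < 1 →
          y ^ N ∈ Ideal.span (Set.range fun δ : Derivation ℤ (R i) (R i) => δ ⟨s i ^ p, hf⟩))

/-- **`stub_core4Dictionary` (registered stub of crux `Steer`, line `switching_dichotomy` r9/r10) — PROVED.**
Along a zero-dimensional valuation over a perfect field, an eternal torsor run along the quadratic sequence of a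
base regular at the centre is non-isolated at infinitely many stages; `IsolatedForcedTermination` consumed.
[cite: HauserPerlega2019, §§2–3] -/
theorem stub_core4Dictionary : Sig.stub_core4Dictionary :=
  Core4Dictionary.stub_core4Dictionary_of_chartStep Core4Dictionary.dictT2_holds

end Summit.ResolutionOfSingularities.ResolutionOfSingularities.Theorems.SwitchingDichotomy

end
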